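import Summits.SmoothPoincare4.SmoothPoincare4.Theses.RootDecompP

/-!
# RootDecompP — glue of the split «GluckWidth» of `GluckTwistsStandard`

Proves the glue item `GluckTwistsStandardGlue` (stmt-SmoothPoincare4-30628, support, rank 404) of
route-SmoothPoincare4-RootDecompP:
`GluckWidthLEFour → GluckWidthSix → GluckWidthGEEight → GluckTwistsStandard`
(stmt-SmoothPoincare4-30625 → 30626 → 30627 → 17711).

Pure logic (excluded middle on «`X` is the Gluck twist of SOME 2-knot `K'` in Morse position of height `(-1,1)` with
at most 6 critical points», then `c ≤ 4 ∨ 4 < c ≤ 6` on that count; otherwise every Morse-position representative has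
more than 6 critical points, which is the hypothesis of `GluckWidthGEEight`). Root decomposition cell decomp-sp4
(D-0178), LANDING LIST 2 (writer g6); 0 sorry. Nothing here proves `SmoothPoincare4`.
-/

set_option linter.dupNamespace false

open scoped Manifold ContDiff

namespace Summit.SmoothPoincare4.SmoothPoincare4.Theorems.RootDecompPGluckTwistsStandardSplit

open Summit.SmoothPoincare4.SmoothPoincare4.Theses.RootDecompP

/-- Item stmt-SmoothPoincare4-30628: the three width cells re-assemble the parent `GluckTwistsStandard`. -/
theorem gluckTwistsStandardGlue_holds : GluckTwistsStandardGlue := by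
  intro h₄ h₆ h₈ K X _ _ _ _ _ hX
  by_cases hex : ∃ K' : Literature.Topology.FourManifolds.TwoKnot,
      Literature.Topology.FourManifolds.IsGluckTwist (𝓡 4) X K' ∧
      Literature.Topology.FourManifolds.IsMorse (𝓡 2)
        (fun x : Metric.sphere (0 : EuclideanSpace ℝ (Fin 3)) 1 => (K' x : EuclideanSpace ℝ (Fin 5)) (Fin.last 4)) ∧
      (∀ x : Metric.sphere (0 : EuclideanSpace ℝ (Fin 3)) 1,
        (K' x : EuclideanSpace ℝ (Fin 5)) (Fin.last 4) ∈ Set.Ioo (-1 : ℝ) 1) ∧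
      (Literature.Topology.FourManifolds.criticalSet (𝓡 2)
        (fun x : Metric.sphere (0 : EuclideanSpace ℝ (Fin 3)) 1 => (K' x : EuclideanSpace ℝ (Fin 5)) (Fin.last 4))).ncard ≤ 6
  · obtain ⟨K', hK', hM, hI, hc⟩ := hex
    by_cases hc4 : (Literature.Topology.FourManifolds.criticalSet (𝓡 2)
        (fun x : Metric.sphere (0 : EuclideanSpace ℝ (Fin 3)) 1 => (K' x : EuclideanSpace ℝ (Fin 5)) (Fin.last 4))).ncard ≤ 4
    · exact h₄ K' X hK' hM hI hc4
    · exact h₆ K' X hK' hM hI ⟨by omega, hc⟩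
  · refine h₈ K X hX fun K' hK' hM hI => ?_
    by_contra hle
    exact hex ⟨K', hK', hM, hI, by omega⟩

end Summit.SmoothPoincare4.SmoothPoincare4.Theorems.RootDecompPGluckTwistsStandardSplit
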